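import Summits.HodgeConjecture.HodgeConjecture.Theorems.MarkmanPartnerTransportK3Sq2TypeHodgeOfCycleInducedGenerator
import Summits.HodgeConjecture.HodgeConjecture.Theorems.MarkmanPartnerTransportPartnerTransportIncidence
import Summits.HodgeConjecture.HodgeConjecture.Theorems.MarkmanPartnerTransportIsometrySpannedThirdTopDegree
import Summits.HodgeConjecture.HodgeConjecture.Theorems.MarkmanPartnerTransportK3Sq2TypeHodgeHKSpreadOfCycleInduced
import Summits.HodgeConjecture.HodgeConjecture.Theorems.MarkmanPartnerTransportPicardThreeK3SquaresRMSpreadOfCycleInduced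
import Literature.AlgebraicGeometry.HodgeTheory.CorrespondenceTranspose
import Literature.AlgebraicGeometry.Hyperkaehler.K3HilbertSquareIncidence

/-!
# Route MarkmanPartnerTransport · cruxes `PicardThreeK3Squares` (#4, stmt-HodgeConjecture-19652) and
# `LowPicardRealMultiplication` (#5, stmt-HodgeConjecture-19653) — CYCLE-INDUCEDNESS TRANSPORTS FROM A
# SURFACE TO ITS HILBERT SQUARE: the `X`-side spread input at Hilbert squares REDUCES to the K3-side one

Both real-multiplication cruxes of the route are in closed form «one generator `t` of `E = End_Hdg T` is
CYCLE-INDUCED»: on the K3 side `RMSpreadFamily S hS t` / `hodgeConjectureFor_square_of_isRealMultiplicationK3_of_spreadFamilies'`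
(fact-free), on the `X` side (`K3^{[2]}`-type fourfolds) `HKSpreadFamily X hX t` / the `X`-side F4
`hodgeConjectureFor_of_cycleInducedGenerator` (mod {Verbitsky–Guan, O'Grady, Charles–Markman}); both structures
are LOSSLESS (`nonempty_rmSpreadFamily_iff_exists_algebraicClass`, `nonempty_hkSpreadFamily_iff_exists_algebraicClass`).
This file is the BRIDGE between the two sides at the Hilbert squares `H = S^{[2]}` — the model objects of
crux #5 (`ρ(S) = 2 ⇒ ρ(H) = 3`; van Geemen–Schütt's maximal family Thm. 1.1 (11)), where the route owner asked
for «the Hilbert-square reduction of the `X`-side (I2) to the K3-side one via `T(X) ≅ T(S)`» (P1 g35).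

Setting (all hypotheses DISPLAYED; the instance from the printed facts is §5): `S` a smooth projective surface
whose cup form on `H²` is the K3 form in a marking `η` with top generator `p` (`a ∪ b = (η a · η b) • p`);
`H` a smooth projective fourfold with a Beauville–Bogomolov marking `IsMarkedK3Hilb 2 H φ_H P_H`, `P_H ≠ 0`,
whose O'Grady class `q^∨ = dualBBFClass 2 φ_H` is algebraic; an ALGEBRAIC class `θ ∈ N²H⁴((H ⊗ S)(ℂ); ℂ)`
acting as Beauville's marked incidence, `φ_H([θ]_* a) = (η a, 0)` (the output clause of
`Beauville1983_hilbertSquare_markedIncidence`); `π := η⁻¹ ∘ pr_{Λ_{K3}} ∘ φ_H : H²(H) → H²(S)` the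
Beauville–Bogomolov retraction (`π ∘ [θ]_* = id`, `π(δ) = 0`; route file `…PartnerTransportIncidence`).

* §1 `exists_corrAction_comp` — **algebraic correspondences compose** in all dimensions and degrees
  (Fulton Prop. 16.1.1): `corr_comp_of_baseChange` + `gysin_baseChange` + `corrCompClass_mem_algebraicClasses`
  + `Theorems.Voisin2003_cupProduct_algebraicClasses_holds`, all tree theorems (generalises
  `exists_corrAction_comp_fourfold`, `corrComp_surfaces_of_cup`).
* §2 `exists_algebraicClass_corrAction_eq_retraction` — **the retraction `π` is CYCLE-INDUCED**:
  `π = c⁻¹ · [ᵗ(θ ∪ pr_H^* q^∨)]_*`, `c = 25 ∫_H P_H / ∫_S p`, by O'Grady's identity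
  `(q^∨ ∪ a) ∪ b = 25 q(a, b) P_H` (`dualBBFClass_cup_cup`, kernel), the projection formula
  (`corrAction_cup_map_fst`), the adjunction `∫_S (ᵗW)_* w ∪ a = ∫_H W_* a ∪ w`
  (`traceC_corrAction_map_swap_cup`, Kahn Lemma 3.48) and Poincaré duality on `S` — the BBF-adjoint of an
  algebraic correspondence into a `K3^{[2]}`-type fourfold is algebraic BECAUSE `q^∨` IS; also
  `generator_ne_zero_of_cupForm` (`p ≠ 0`).
* §3 `exists_algebraicClass_corrAction_eq_transport` — **if `t = [γ]_*` with `γ ∈ N²H⁴(S ⊗ S)` then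
  `t_H := [θ]_* ∘ t ∘ π = [Z]_*` with `Z = θ ∘ γ ∘ Λ ∈ N⁴H⁸(H ⊗ H)`** (`= [θ]_* t [θ]_*⁻¹ ⊕ 0` on
  `H²(H) = [θ]_* H²(S) ⊕ ℂδ`): verbatim the input `ht_cyc` of the `X`-side F4 and the right-hand side of
  `nonempty_hkSpreadFamily_iff_exists_algebraicClass`.
* §4 `nonempty_hkSpreadFamily_of_nonempty_rmSpreadFamily` — **(I1′)+(I2) on the K3 side ⟹ (I1′-X)+(I2-X) for
  the Hilbert square**: `Nonempty (RMSpreadFamily S hS t) → Nonempty (HKSpreadFamily H hH t_H)`.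
* §5 `exists_hilbertSquare_cycleInduced_transport` — the instance for a marked projective K3 surface, modulo
  the two printed facts {Beauville 1983 §6 marked incidence, O'Grady 2008 `q^∨` algebraic}.

Honest status: a REDUCTION (the `X`-side cycle-inducedness ∕ spread input at Hilbert squares is implied by the
K3-side one), no new case of the Hodge conjecture (HC⁴(S^{[2]}) ⟸ K3-side spread family is already
`hodgeConjectureFor_hilbertSquare_of_rmSpreadFamily`, mod Beauville–Fogarty); no definition, no sorry, no new
named fact; credits nothing; crux #4, crux #5 and HC stay open. Prover seat hodge-nonav-19716-p2 (gen 4),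
`--supports stmt-HodgeConjecture-19653`.

References: A. Beauville, J. Differential Geom. 18 (1983) §6 Prop. 6, §9 Lemme 1; K. O'Grady, Commun.
Contemp. Math. 10 (2008) §3 Claim 3.1, Prop. 3.2; W. Fulton, *Intersection Theory* §16.1 Prop. 16.1.1;
B. Kahn, *Zeta and L-functions of varieties and motives* (2020) §3.5.3 Lemma 3.48; B. van Geemen, M. Schütt,
Forum Math. Sigma 13 (2025) e2, Thm. 1.1 (11), §4.8; C. Voisin, *Hodge Theory II* (2003), (10.7), Prop. 9.20.
-/

noncomputable section

set_option linter.dupNamespace false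

open Module CategoryTheory MonoidalCategory CartesianMonoidalCategory
open Literature.AlgebraicTopology.SingularHomology Literature.Geometry.Kaehler
open Literature.AlgebraicGeometry Literature.AlgebraicGeometry.Motives Literature.AlgebraicGeometry.HodgeTheory
open Literature.AlgebraicGeometry.Hyperkaehler Literature.AlgebraicGeometry.Surfaces
open Summit.HodgeConjecture.HodgeConjecture.Theorems.NikulinTwinTransport
open Summit.HodgeConjecture.HodgeConjecture.Theorems.MarkmanPartnerTransport.BBFPositivity

namespace Summit.HodgeConjecture.HodgeConjecture.Theorems.MarkmanPartnerTransport.PartnerLattice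

/-- `MarkedK3[S, η, p, x]`: the six K3 marking clauses, VERBATIM those of `Surfaces.Huybrechts_K3_marking_exists`
and of `Beauville1983_hilbertSquare_markedIncidence`. Local notation only. [cite: Huybrechts2016K3, Ch. 1 Prop. 3.5] -/
local notation3 (prettyPrint := false) "MarkedK3[" S ", " η ", " p ", " x "]" =>
  (IsIntegralClass p ∧
    (∀ q : complexBetti S (2 * 2), IsIntegralClass q → ∃ n : ℤ, q = n • p) ∧
    (∀ c : complexBetti S (2 * 1), IsIntegralClass c ↔ ∃ v : K3Index → ℤ, η c = fun i => (v i : ℂ)) ∧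
    (∀ a b : complexBetti S (2 * 1),
        cupProduct (rfl : 2 * 1 + 2 * 1 = 2 * 2) a b = k3Form (η a) (η b) • p) ∧
    IsOfHodgeType 2 S (2 * 1) 2 0 (LinearEquiv.symm η x) ∧
    (∀ τ : complexBetti S (2 * 1), IsOfHodgeType 2 S (2 * 1) 2 0 τ → ∃ t : ℂ, τ = t • LinearEquiv.symm η x))

/-- `MarkedK3Sq[X, φ, P, z]`: VERBATIM the `let MarkedK3Sq := …` binder of the route declarations of
MarkmanPartnerTransport (clauses (m1)–(m6)). Local notation only. -/
local notation3 (prettyPrint := false) "MarkedK3Sq[" X ", " φ ", " P ", " z "]" =>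
  (((IsIntegralClass P ∧ ∀ Q : complexBetti X (2 * 4), IsIntegralClass Q → ∃ n : ℤ, Q = n • P) ∧
    (∀ c : complexBetti X 2, IsIntegralClass c ↔ ∃ v : K3HilbertIndex → ℤ, φ c = fun i => (v i : ℂ)) ∧
    (∀ a : complexBetti X 2, cupPowTwo a 4 = ((3 : ℂ) * (k3HilbertForm 2 (φ a) (φ a)) ^ 2) • P) ∧
    (IsOfHodgeType 4 X 2 2 0 (LinearEquiv.symm φ z) ∧
      ∀ τ : complexBetti X 2, IsOfHodgeType 4 X 2 2 0 τ → ∃ t : ℂ, τ = t • LinearEquiv.symm φ z) ∧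
    (∀ c : complexBetti X 2, IsOfHodgeType 4 X 2 1 1 c ↔
      (k3HilbertForm 2 (φ c) z = 0 ∧ k3HilbertForm 2 (φ c) (star z) = 0)) ∧
    (k3HilbertForm 2 z z = 0 ∧ 0 < (k3HilbertForm 2 (star z) z).re)))

/-! ### §1 Algebraic correspondences compose (all dimensions and degrees) -/

/-- **Algebraic correspondences compose** (Fulton Prop. 16.1.1 / Def. 16.1.2; Buskin Lemma 6.3), in all
dimensions and degrees: for smooth projective `X, Y, Z` of dimensions `l, m, n`, `γ ∈ Nᵉ H²ᵉ(X ⊗ Y)` and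
`γ' ∈ Nᵉ' H²ᵉ'(Y ⊗ Z)` with `e + e' = e'' + m`, there is `γ'' ∈ Nᵉ'' H²ᵉ''(X ⊗ Z)` — namely
`c • p₁₃_*(p₁₂^* γ ∪ p₂₃^* γ')` — with `[γ'']_* = [γ]_* ∘ [γ']_*` on `Hᵃ(Z(ℂ); ℂ)` (actions
`pr₁_*(pr₂^*(–) ∪ ·)` for the complex orientations). From the tree's `corr_comp_of_baseChange` with the PROVED
base change `gysin_baseChange`, and `corrCompClass_mem_algebraicClasses` with the PROVED multiplicativity
`Theorems.Voisin2003_cupProduct_algebraicClasses_holds` (generalises `exists_corrAction_comp_fourfold` and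
`corrComp_surfaces_of_cup`). [cite: Fulton1998, §16.1 Prop. 16.1.1 and Def. 16.1.2] [cite: Buskin2019, Lemma 6.3] -/
theorem exists_corrAction_comp {l m n : ℕ} {X Y Z : SchemeOver ℂ}
    (hX : IsSmoothProjective l X) (hY : IsSmoothProjective m Y) (hZ : IsSmoothProjective n Z)
    {e e' e'' a a₁ a₂ : ℕ} (h₁ : a + 2 * e' = a₁ + 2 * n) (h₂ : a₁ + 2 * e = a₂ + 2 * m)
    (he : e + e' = e'' + m) (h₃ : a + 2 * e'' = a₂ + 2 * n)
    {γ : complexBetti (X ⊗ Y) (2 * e)} (hγ : γ ∈ algebraicClasses (X ⊗ Y) e)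
    {γ' : complexBetti (Y ⊗ Z) (2 * e')} (hγ' : γ' ∈ algebraicClasses (Y ⊗ Z) e') :
    ∃ γ'' ∈ algebraicClasses (X ⊗ Z) e'', ∀ y : complexBetti Z a,
      corrAction complexOrientationFamily hX hZ h₃ γ'' y =
        corrAction complexOrientationFamily hX hY h₂ γ
          (corrAction complexOrientationFamily hY hZ h₁ γ' y) := by
  set μ : OrientationFamily := complexOrientationFamily with hμdef
  have hμ : μ.HasPoincareDuality := OrientationFamily.hasPoincareDuality μ
  obtain ⟨c, hc⟩ := gysin_baseChange μ hX hY hZ (show a + 2 * e' + 2 * m = a₁ + 2 * (m + n) by omega)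
  have hCUP : ∀ u ∈ algebraicClasses (X ⊗ (Y ⊗ Z)) e, ∀ v ∈ algebraicClasses (X ⊗ (Y ⊗ Z)) e',
      cupProduct ((Nat.mul_add 2 e e').symm : 2 * e + 2 * e' = 2 * (e + e')) u v ∈
        algebraicClasses (X ⊗ (Y ⊗ Z)) (e + e') := fun u hu v hv =>
    Theorems.Voisin2003_cupProduct_algebraicClasses_holds
      (IsSmoothProjective.tensor_holds hX (IsSmoothProjective.tensor_holds hY hZ)) hu hv
  refine ⟨c • complexGysin μ
      (IsSmoothProjective.tensor_holds hX (IsSmoothProjective.tensor_holds hY hZ))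
      (IsSmoothProjective.tensor_holds hX hZ) (X ◁ snd Y Z)
      (show 2 * (e + e') + 2 * (l + n) = 2 * e'' + 2 * (l + (m + n)) by omega)
      (cupProduct ((Nat.mul_add 2 e e').symm : 2 * e + 2 * e' = 2 * (e + e'))
        (complexBetti.map (X ◁ fst Y Z) (2 * e) γ) (complexBetti.map (snd X (Y ⊗ Z)) (2 * e') γ')),
    Submodule.smul_mem _ c (corrCompClass_mem_algebraicClasses hμ hX hY hZ (e := e) (e' := e')
      (e'' := e'') he hCUP hγ hγ'), fun y ↦ ?_⟩
  rw [corrAction_apply, corrAction_apply, corrAction_apply]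
  exact corr_comp_of_baseChange hμ hX hY hZ (e := e) (j := 2 * e') (k := 2 * e'') (d := 2 * (e + e'))
    (a := a) (a₁ := a₁) (a₂ := a₂) h₁ h₂ (by omega) ((Nat.mul_add 2 e e').symm) γ γ' c hc y

/-! ### §2 The Beauville–Bogomolov retraction `π : H²(H) → H²(S)` is cycle-induced -/

variable {S H : SchemeOver ℂ} {η : complexBetti S (2 * 1) ≃ₗ[ℂ] (K3Index → ℂ)} {p : complexBetti S (2 * 2)}
  {φH : complexBetti H 2 ≃ₗ[ℂ] (K3HilbertIndex → ℂ)} {PH : complexBetti H (2 * 4)}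
  {θ : complexBetti (H ⊗ S) (2 * 2)}

/-- **`[θ ∪ pr_H^* q]_* a = q ∪ [θ]_* a`** for `θ ∈ H⁴((H ⊗ S)(ℂ))`, `q ∈ H⁴(H(ℂ))`, `a ∈ H²(S(ℂ))`
(associativity and graded commutativity of `∪`, and the projection formula
`pr_{H*}(pr_H^* q ∪ y) = q ∪ pr_{H*} y`, `complexGysin_cup`). [cite: FultonYoungTableaux1997, Appendix B §B.1 (3) and (6)]
[cite: VoisinHodgeII2003, proof of Thm. 10.17 (10.7)] -/
theorem corrAction_cup_map_fst (hS : IsSmoothProjective 2 S) (hH : IsSmoothProjective 4 H)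
    (θ : complexBetti (H ⊗ S) (2 * 2)) (q : complexBetti H (2 * 2)) (a : complexBetti S (2 * 1)) :
    corrAction complexOrientationFamily hH hS (rfl : 2 * 1 + 2 * 4 = 2 * 3 + 2 * 2)
        (cupProduct (rfl : 2 * 2 + 2 * 2 = 2 * 4) θ (complexBetti.map (fst H S) (2 * 2) q)) a =
      cupProduct (rfl : 2 * 2 + 2 = 2 * 3) q
        (corrAction complexOrientationFamily hH hS (rfl : 2 * 1 + 2 * 2 = 2 + 2 * 2) θ a) := by
  have hμ : complexOrientationFamily.HasPoincareDuality := hasPoincareDuality_complexOrientationFamily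
  have hHS := IsSmoothProjective.tensor_holds hH hS
  rw [corrAction_apply, corrAction_apply]
  -- `pr_S^* a ∪ (θ ∪ pr_H^* q) = pr_H^* q ∪ (pr_S^* a ∪ θ)`
  have hrew : cupProduct (rfl : 2 * 1 + 2 * 4 = 2 * 1 + 2 * 4) (complexBetti.map (snd H S) (2 * 1) a)
        (cupProduct (rfl : 2 * 2 + 2 * 2 = 2 * 4) θ (complexBetti.map (fst H S) (2 * 2) q)) =
      cupProduct (show 2 * 2 + (2 * 1 + 2 * 2) = 2 * 1 + 2 * 4 by norm_num)
        (complexBetti.map (fst H S) (2 * 2) q)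
        (cupProduct (rfl : 2 * 1 + 2 * 2 = 2 * 1 + 2 * 2) (complexBetti.map (snd H S) (2 * 1) a) θ) := by
    rw [← cupProduct_assoc (rfl : 2 * 1 + 2 * 2 = 2 * 1 + 2 * 2) (rfl : 2 * 2 + 2 * 2 = 2 * 4)
        (show 2 * 1 + 2 * 2 + 2 * 2 = 2 * 1 + 2 * 4 by norm_num) (rfl : 2 * 1 + 2 * 4 = 2 * 1 + 2 * 4),
      cupProduct_gradedComm_holds ℂ _ (show 2 * 1 + 2 * 2 + 2 * 2 = 2 * 1 + 2 * 4 by norm_num)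
        (show 2 * 2 + (2 * 1 + 2 * 2) = 2 * 1 + 2 * 4 by norm_num)]
    norm_num
  rw [hrew, complexGysin_cup hμ hHS hH (fst H S) (p := 2 * 2) (q := 2 * 1 + 2 * 2)
      (show 2 * 2 + (2 * 1 + 2 * 2) = 2 * 1 + 2 * 4 by norm_num) _
      (show 2 * 1 + 2 * 2 + 2 * 4 = 2 + 2 * (4 + 2) by norm_num) (rfl : 2 * 2 + 2 = 2 * 3)]


/-- The marking generator `p` of `H⁴(S)` is non-zero as soon as the cup form of `S` is the K3 form in the
marking `η` (`a ∪ b = (η a · η b) • p`): `k3Form e e = -2 ≠ 0` for a root `e` of the `E₈(-1)`-block, while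
`p = 0` would force `a ∪ b = 0` for all `a, b`. [cite: Beauville1983, §8 Thm. 5] [cite: HatcherAT2002, §3.3 Prop. 3.38] -/
theorem generator_ne_zero_of_cupForm (hS : IsSmoothProjective 2 S)
    (hcupS : ∀ a b : complexBetti S (2 * 1),
      cupProduct (rfl : 2 * 1 + 2 * 1 = 2 * 2) a b = k3Form (η a) (η b) • p) : p ≠ 0 := by
  intro hp
  -- every class of `H²(S)` is then zero by Poincaré duality, contradicting `H²(S) ≅ ℂ²²`
  have hzero : ∀ a : complexBetti S (2 * 1), a = 0 := fun a =>
    eq_zero_of_forall_traceC_cup_eq_zero hS (rfl : 2 * 1 + 2 * 1 = 2 * 2) fun b => by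
      rw [hcupS, hp, smul_zero, map_zero]
  have h1 : η.symm (Pi.single (Sum.inr (Sum.inl 0)) 1) = 0 := hzero _
  have h2 := congrArg η h1
  rw [LinearEquiv.apply_symm_apply, map_zero] at h2
  have h3 := congrFun h2 (Sum.inr (Sum.inl 0))
  simp at h3

/-- **The Beauville–Bogomolov retraction `π = η⁻¹ ∘ pr_{Λ_{K3}} ∘ φ_H : H²(H) → H²(S)` is CYCLE-INDUCED.**
Data: a smooth projective surface `S` whose cup form is the K3 form in a marking `η` with generator `p`
(`a ∪ b = (η a · η b) • p`); a smooth projective fourfold `H` with a Beauville–Bogomolov marking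
`IsMarkedK3Hilb 2 H φ_H P_H` (`P_H ≠ 0`) whose dual class `q^∨ = dualBBFClass 2 φ_H` is algebraic (O'Grady);
an ALGEBRAIC class `θ ∈ N²H⁴((H ⊗ S)(ℂ))` acting as Beauville's marked incidence `φ_H([θ]_* a) = (η a, 0)`.
Then `π = [Λ]_*` for an algebraic `Λ ∈ N⁴H⁸((S ⊗ H)(ℂ))`, namely `Λ = c⁻¹ · ᵗ(θ ∪ pr_H^* q^∨)`,
`c = 25 · ∫_H P_H / ∫_S p`: by the adjunction formula (`traceC_corrAction_map_swap_cup`, Kahn Lemma 3.48),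
`corrAction_cup_map_fst` and O'Grady's identity `(q^∨ ∪ a) ∪ b = 25 q(a, b) P_H` (`dualBBFClass_cup_cup`),
`∫_S [ᵗ(θ ∪ pr_H^* q^∨)]_* w ∪ a = ∫_H (q^∨ ∪ [θ]_* a) ∪ w = 25 q((η a, 0), φ_H w) ∫_H P_H = c ∫_S π(w) ∪ a`
for all `a`, and Poincaré duality on `S` concludes. (The BBF-adjoint of an algebraic correspondence into a
`K3^{[2]}`-type fourfold is algebraic because `q^∨` is.) [cite: OGrady2008NumericalK3Square, §3 Claim 3.1]
[cite: Beauville1983, §6 Prop. 6 and §9 Lemme 1] [cite: Kahn2020, §3.5.3 Lemma 3.48]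
[cite: Fulton1998, §16.1 Prop. 16.1.1] -/
theorem exists_algebraicClass_corrAction_eq_retraction (hS : IsSmoothProjective 2 S) (hH : IsSmoothProjective 4 H)
    (hcupS : ∀ a b : complexBetti S (2 * 1),
      cupProduct (rfl : 2 * 1 + 2 * 1 = 2 * 2) a b = k3Form (η a) (η b) • p)
    (hMK : IsMarkedK3Hilb 2 H φH PH) (hPH : PH ≠ 0) (hqd : dualBBFClass 2 φH ∈ algebraicClasses H 2)
    (hθ : θ ∈ algebraicClasses (H ⊗ S) 2)
    (hi : ∀ a : complexBetti S (2 * 1),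
      φH (corrAction complexOrientationFamily hH hS (rfl : 2 * 1 + 2 * 2 = 2 + 2 * 2) θ a) = Sum.elim (η a) 0) :
    ∃ Λ ∈ algebraicClasses (S ⊗ H) 4, ∀ w : complexBetti H 2,
      corrAction complexOrientationFamily hS hH (rfl : 2 + 2 * 4 = 2 * 1 + 2 * 4) Λ w =
        η.symm (fun k => φH w (Sum.inl k)) := by
  have hHS := IsSmoothProjective.tensor_holds hH hS
  have hSH := IsSmoothProjective.tensor_holds hS hH
  have hp : p ≠ 0 := generator_ne_zero_of_cupForm hS hcupS
  -- the class `W₀ = θ ∪ pr_H^* q^∨ ∈ N⁴H⁸(H ⊗ S)` and its transpose `Λ₀ = ᵗW₀ ∈ N⁴H⁸(S ⊗ H)`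
  set qd : complexBetti H (2 * 2) := dualBBFClass 2 φH with hqddef
  set W₀ : complexBetti (H ⊗ S) (2 * 4) :=
    cupProduct (rfl : 2 * 2 + 2 * 2 = 2 * 4) θ (complexBetti.map (fst H S) (2 * 2) qd) with hW₀def
  have hW₀ : W₀ ∈ algebraicClasses (H ⊗ S) 4 := by
    -- (degree bookkeeping `2 + 2 = 4` via `convert`, which is fast here; a direct term is a `whnf` time-out)
    have h := Theorems.Voisin2003_cupProduct_algebraicClasses_holds hHS hθ (map_fst_mem_supportedClasses hH hS hqd)
    rw [hW₀def]
    convert h using 2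
  set Λ₀ : complexBetti (S ⊗ H) (2 * 4) := complexBetti.map (lift (snd S H) (fst S H)) (2 * 4) W₀ with hΛ₀def
  have hΛ₀ : Λ₀ ∈ algebraicClasses (S ⊗ H) 4 :=
    fulton1998_map_mem_algebraicClasses_holds _ hHS hSH 4 W₀ hW₀
  -- the scalar `c = 25 ∫_H P_H / ∫_S p ≠ 0`
  have hτH : traceC hH PH ≠ 0 := fun h => hPH (eq_zero_of_traceC_eq_zero hH h)
  have hτS : traceC hS p ≠ 0 := fun h => hp (eq_zero_of_traceC_eq_zero hS h)
  set c : ℂ := 25 * traceC hH PH * (traceC hS p)⁻¹ with hcdef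
  have hc : c ≠ 0 := mul_ne_zero (mul_ne_zero (by norm_num) hτH) (inv_ne_zero hτS)
  -- `[Λ₀]_* w = c • π w`
  have key : ∀ w : complexBetti H 2,
      corrAction complexOrientationFamily hS hH (rfl : 2 + 2 * 4 = 2 * 1 + 2 * 4) Λ₀ w =
        c • η.symm (fun k => φH w (Sum.inl k)) := by
    intro w
    rw [← sub_eq_zero]
    refine eq_zero_of_forall_traceC_cup_eq_zero hS (rfl : 2 * 1 + 2 * 1 = 2 * 2) fun a => ?_
    have hadj := traceC_corrAction_map_swap_cup hH hS (e := 4) (a := 2 * 1) (a' := 2) (b := 2 * 3)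
      (b' := 2 * 1) rfl rfl rfl rfl W₀ w a
    rw [show ((-1 : ℂ) ^ (2 * 1 * 2)) = 1 by norm_num, one_mul, hW₀def,
      corrAction_cup_map_fst hS hH θ qd a, hqddef, dualBBFClass_cup_cup hMK, map_smul, hi,
      k3HilbertForm_sumElim_zero_left, smul_eq_mul] at hadj
    rw [map_sub, LinearMap.sub_apply, map_sub, hΛ₀def, hW₀def, hqddef, hadj, map_smul, LinearMap.smul_apply,
      map_smul, hcupS, LinearEquiv.apply_symm_apply, map_smul, smul_eq_mul, smul_eq_mul,
      k3Form_comm (fun k => φH w (Sum.inl k)) (η a), hcdef]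
    field_simp
    ring
  refine ⟨c⁻¹ • Λ₀, Submodule.smul_mem _ _ hΛ₀, fun w => ?_⟩
  rw [map_smul, LinearMap.smul_apply, key, smul_smul, inv_mul_cancel₀ hc, one_smul]


/-! ### §3 Cycle-inducedness transports from `S` to `H` -/

/-- **CYCLE-INDUCEDNESS TRANSPORTS TO THE HILBERT SQUARE.**  In the situation of
`exists_algebraicClass_corrAction_eq_retraction` (Beauville's algebraic incidence `θ ∈ N²H⁴(H ⊗ S)` with
`φ_H([θ]_* a) = (η a, 0)`, O'Grady's class algebraic), let `t` be an endomorphism of `H²(S(ℂ); ℂ)` induced by an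
algebraic class `γ ∈ N²H⁴((S ⊗ S)(ℂ))`, `t = [γ]_*`. Then the TRANSPORTED endomorphism
`t_H := [θ]_* ∘ t ∘ π` of `H²(H(ℂ); ℂ)` (`π = η⁻¹ ∘ pr_{Λ_{K3}} ∘ φ_H` the Beauville–Bogomolov retraction; in the
decomposition `H²(H) = [θ]_* H²(S) ⊕ ℂδ`, `t_H = [θ]_* t [θ]_*⁻¹ ⊕ 0`) is induced by an algebraic class
`Z ∈ N⁴H⁸((H ⊗ H)(ℂ))`: `Z = θ ∘ γ ∘ Λ` (two compositions of algebraic correspondences,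
`exists_corrAction_comp`). This is exactly the cycle-inducedness input `ht_cyc` of the `X`-side F4
`hodgeConjectureFor_of_cycleInducedGenerator` and the right-hand side of
`nonempty_hkSpreadFamily_iff_exists_algebraicClass`, for the Hilbert square. [cite: Fulton1998, §16.1 Prop. 16.1.1]
[cite: Beauville1983, §6 Prop. 6 and §9 Lemme 1] [cite: OGrady2008NumericalK3Square, §3 Claim 3.1]
[cite: GeemenSchutt2023, §4.8] -/
theorem exists_algebraicClass_corrAction_eq_transport (hS : IsSmoothProjective 2 S) (hH : IsSmoothProjective 4 H)
    (hcupS : ∀ a b : complexBetti S (2 * 1),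
      cupProduct (rfl : 2 * 1 + 2 * 1 = 2 * 2) a b = k3Form (η a) (η b) • p)
    (hMK : IsMarkedK3Hilb 2 H φH PH) (hPH : PH ≠ 0) (hqd : dualBBFClass 2 φH ∈ algebraicClasses H 2)
    (hθ : θ ∈ algebraicClasses (H ⊗ S) 2)
    (hi : ∀ a : complexBetti S (2 * 1),
      φH (corrAction complexOrientationFamily hH hS (rfl : 2 * 1 + 2 * 2 = 2 + 2 * 2) θ a) = Sum.elim (η a) 0)
    {t : complexBetti S (2 * 1) →ₗ[ℂ] complexBetti S (2 * 1)}
    (ht : ∃ γ ∈ algebraicClasses (S ⊗ S) 2, ∀ y : complexBetti S (2 * 1),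
      t y = corrAction complexOrientationFamily hS hS (rfl : 2 * 1 + 2 * 2 = 2 * 1 + 2 * 2) γ y) :
    ∃ Z ∈ algebraicClasses (H ⊗ H) 4, ∀ w : complexBetti H 2,
      corrAction complexOrientationFamily hH hH (rfl : 2 + 2 * 4 = 2 + 2 * 4) Z w =
        corrAction complexOrientationFamily hH hS (rfl : 2 * 1 + 2 * 2 = 2 + 2 * 2) θ
          (t (η.symm (fun k => φH w (Sum.inl k)))) := by
  obtain ⟨Λ, hΛ, hπ⟩ := exists_algebraicClass_corrAction_eq_retraction hS hH hcupS hMK hPH hqd hθ hi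
  obtain ⟨γ, hγ, hγt⟩ := ht
  -- `γ ∘ Λ ∈ N⁴H⁸(S ⊗ H)` acts as `t ∘ π`
  obtain ⟨Z₁, hZ₁, hZ₁t⟩ := exists_corrAction_comp hS hS hH (e := 2) (e' := 4) (e'' := 4) (a := 2)
    (a₁ := 2 * 1) (a₂ := 2 * 1) (rfl : 2 + 2 * 4 = 2 * 1 + 2 * 4) (rfl : 2 * 1 + 2 * 2 = 2 * 1 + 2 * 2)
    (rfl : 2 + 4 = 4 + 2) (rfl : 2 + 2 * 4 = 2 * 1 + 2 * 4) hγ hΛ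
  -- `θ ∘ (γ ∘ Λ) ∈ N⁴H⁸(H ⊗ H)` acts as `[θ]_* ∘ t ∘ π`
  obtain ⟨Z, hZ, hZt⟩ := exists_corrAction_comp hH hS hH (e := 2) (e' := 4) (e'' := 4) (a := 2)
    (a₁ := 2 * 1) (a₂ := 2) (rfl : 2 + 2 * 4 = 2 * 1 + 2 * 4) (rfl : 2 * 1 + 2 * 2 = 2 + 2 * 2)
    (rfl : 2 + 4 = 4 + 2) (rfl : 2 + 2 * 4 = 2 + 2 * 4) hθ hZ₁
  exact ⟨Z, hZ, fun w => by rw [hZt, hZ₁t, hπ, hγt]⟩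

/-- The transported endomorphism `t_H = [θ]_* ∘ t ∘ π` of `H²(H(ℂ); ℂ)` as a linear map, for the
corollaries below (`π = η⁻¹ ∘ (· ∘ Sum.inl) ∘ φ_H`). Local notation only. -/
local notation3 (prettyPrint := false) "Transported[" hH ", " hS ", " θ ", " η ", " φH ", " t "]" =>
  (corrAction complexOrientationFamily hH hS (rfl : 2 * 1 + 2 * 2 = 2 + 2 * 2) θ) ∘ₗ t ∘ₗ
    ((LinearEquiv.symm η : (K3Index → ℂ) →ₗ[ℂ] _) ∘ₗ
      LinearMap.funLeft ℂ ℂ (Sum.inl : K3Index → K3HilbertIndex) ∘ₗ (φH : _ →ₗ[ℂ] (K3HilbertIndex → ℂ)))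

/-! ### §4 The `X`-side spread input at Hilbert squares reduces to the K3-side one -/

/-- **(I1′)+(I2) on the K3 side ⟹ (I1′-X)+(I2-X) for the Hilbert square.**  A spread family
`RMSpreadFamily S hS t` for `(S, t)` (route files `…RMSpreadDefs` / `…PicardThreeK3SquaresRMSpread`) yields
a spread family `HKSpreadFamily H hH t_H` for the Hilbert square and the transported endomorphism
`t_H = [θ]_* ∘ t ∘ π` (`…HKSpreadDefs` / `…K3Sq2TypeHodgeOfHKSpread`): both structures are LOSSLESS encodings
of cycle-inducedness (`nonempty_rmSpreadFamily_iff_exists_algebraicClass`,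
`nonempty_hkSpreadFamily_iff_exists_algebraicClass`), and cycle-inducedness transports
(`exists_algebraicClass_corrAction_eq_transport`). Hence, for Hilbert squares of K3 surfaces with real
multiplication, the `X`-side open input of crux #5 `LowPicardRealMultiplication` IS the K3-side open input of
crux #4 (in particular for van Geemen–Schütt's maximal family Thm. 1.1 (11): `ρ(S) = 2`, `ρ(S^{[2]}) = 3`).
[cite: GeemenSchutt2023, Thm. 1.1 (11), §3.4 and §4.8] [cite: Beauville1983, §6 Prop. 6]
[cite: OGrady2008NumericalK3Square, §3 Claim 3.1] -/
theorem nonempty_hkSpreadFamily_of_nonempty_rmSpreadFamily (hS : IsSmoothProjective 2 S)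
    (hH : IsSmoothProjective 4 H)
    (hcupS : ∀ a b : complexBetti S (2 * 1),
      cupProduct (rfl : 2 * 1 + 2 * 1 = 2 * 2) a b = k3Form (η a) (η b) • p)
    (hMK : IsMarkedK3Hilb 2 H φH PH) (hPH : PH ≠ 0) (hqd : dualBBFClass 2 φH ∈ algebraicClasses H 2)
    (hθ : θ ∈ algebraicClasses (H ⊗ S) 2)
    (hi : ∀ a : complexBetti S (2 * 1),
      φH (corrAction complexOrientationFamily hH hS (rfl : 2 * 1 + 2 * 2 = 2 + 2 * 2) θ a) = Sum.elim (η a) 0)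
    {t : complexBetti S (2 * 1) →ₗ[ℂ] complexBetti S (2 * 1)} (hF : Nonempty (RMSpreadFamily S hS t)) :
    Nonempty (HKSpreadFamily H hH (Transported[hH, hS, θ, η, φH, t])) := by
  refine (nonempty_hkSpreadFamily_iff_exists_algebraicClass hH _).2 ?_
  have ht : ∃ γ ∈ algebraicClasses (S ⊗ S) 2, ∀ y : complexBetti S (2 * 1),
      t y = corrAction complexOrientationFamily hS hS (rfl : 2 * 1 + 2 * 2 = 2 * 1 + 2 * 2) γ y := by
    obtain ⟨γ, hγ, hγt⟩ := (nonempty_rmSpreadFamily_iff_exists_algebraicClass hS t).1 hF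
    exact ⟨γ, hγ, fun y => by rw [hγt y, corrAction_apply]⟩
  obtain ⟨Z, hZ, hZt⟩ := exists_algebraicClass_corrAction_eq_transport hS hH hcupS hMK hPH hqd hθ hi ht
  exact ⟨Z, hZ, fun w => by rw [hZt w]; rfl⟩


/-! ### §5 The instance from the two published facts: Hilbert squares of projective K3 surfaces -/

/-- **For a marked projective K3 surface `S`, Beauville's marked Hilbert square `H = S^{[2]}` receives every
cycle-induced endomorphism of `H²(S)` as a CYCLE-INDUCED endomorphism of `H²(H)`**, modulo the two printed
facts `Beauville1983_hilbertSquare_markedIncidence` (existence of `(H, Ξ, φ_H, P_H, θ)`: Hilbert square,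
`K3^{[2]}`-type, BBF-marked of period `(x, 0)`, algebraic incidence `θ` with `φ_H([θ]_* a) = (η a, 0)`) and
`OGrady2008_dualBBFClass_algebraic` (`q^∨` algebraic): for EVERY `t = [γ]_*`, `γ ∈ N²H⁴(S ⊗ S)`, the transport
`[θ]_* ∘ t ∘ π` is `[Z]_*` with `Z ∈ N⁴H⁸(H ⊗ H)`. With van Geemen–Schütt's cycle-induced real multiplication
(`IsCycleInducedRMK3`, e.g. the maximal families Thm. 1.1 (9), (11), Prop. 4.8) this makes the Hilbert squares
NON-VACUOUS instances of the cycle-inducedness input of the `X`-side F4 ∕ `HKSpreadFamily` (crux #5) —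
CONDITIONAL on the two facts; credits nothing towards HC. [cite: Beauville1983, §6 Prop. 6 and Remarque, §9 Lemme 1]
[cite: OGrady2008NumericalK3Square, §3 Claim 3.1 and proof of Prop. 3.2 (6)] [cite: GeemenSchutt2023, Thm. 1.1 (11) and §4.8]
[cite: Fulton1998, §16.1 Prop. 16.1.1] -/
theorem exists_hilbertSquare_cycleInduced_transport (hB : Beauville1983_hilbertSquare_markedIncidence)
    (hO : OGrady2008_dualBBFClass_algebraic) (hK3 : IsK3Surface S) (x : K3Index → ℂ)
    (hM : MarkedK3[S, η, p, x]) (hx0 : k3Form x x = 0) (hxpos : 0 < (k3Form (star x) x).re)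
    (hproj : ∃ u : K3Index → ℤ, k3Form (fun i => (u i : ℂ)) x = 0 ∧ 0 < ∑ i, ∑ j, u i * k3Gram i j * u j) :
    ∃ (H : SchemeOver ℂ) (hH : IsSmoothProjective 4 H) (Ξ : (S ⊗ H).left.IdealSheafData)
      (φH : complexBetti H 2 ≃ₗ[ℂ] (K3HilbertIndex → ℂ)) (PH : complexBetti H (2 * 4)),
      HilbertScheme.IsHilbertSchemeOfPoints 2 S H Ξ ∧ IsOfK3HilbertSquareType H ∧
      MarkedK3Sq[H, φH, PH, Sum.elim x 0] ∧
      ∃ θ ∈ algebraicClasses (H ⊗ S) 2,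
        (∀ a : complexBetti S (2 * 1),
          φH (corrAction complexOrientationFamily hH hK3.isSmoothProjective
            (rfl : 2 * 1 + 2 * 2 = 2 + 2 * 2) θ a) = Sum.elim (η a) 0) ∧
        ∀ t : complexBetti S (2 * 1) →ₗ[ℂ] complexBetti S (2 * 1),
          (∃ γ ∈ algebraicClasses (S ⊗ S) 2, ∀ y : complexBetti S (2 * 1),
            t y = corrAction complexOrientationFamily hK3.isSmoothProjective hK3.isSmoothProjective
              (rfl : 2 * 1 + 2 * 2 = 2 * 1 + 2 * 2) γ y) →
          ∃ Z ∈ algebraicClasses (H ⊗ H) 4, ∀ w : complexBetti H 2,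
            corrAction complexOrientationFamily hH hH (rfl : 2 + 2 * 4 = 2 + 2 * 4) Z w =
              corrAction complexOrientationFamily hH hK3.isSmoothProjective
                (rfl : 2 * 1 + 2 * 2 = 2 + 2 * 2) θ (t (η.symm (fun k => φH w (Sum.inl k)))) := by
  have hS : IsSmoothProjective 2 S := hK3.isSmoothProjective
  obtain ⟨H, hH, Ξ, φH, PH, hHilb, hK, hMH, θ, hθ, hi⟩ :=
    hB complexOrientationFamily hasPoincareDuality_complexOrientationFamily S hK3 η p x hM hx0 hxpos hproj
  obtain ⟨-, -, -, hcupS, -, -⟩ := hM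
  have hMK : IsMarkedK3Hilb 2 H φH PH := isMarkedK3Hilb_of_marked hMH
  have hPH : PH ≠ 0 := generator_ne_zero_of_markedSq hH hMH
  have hqd : dualBBFClass 2 φH ∈ algebraicClasses H 2 := (hO H hH hK φH PH hMK).1
  exact ⟨H, hH, Ξ, φH, PH, hHilb, hK, hMH, θ, hθ, hi, fun t ht =>
    exists_algebraicClass_corrAction_eq_transport hS hH hcupS hMK hPH hqd hθ hi ht⟩

end Summit.HodgeConjecture.HodgeConjecture.Theorems.MarkmanPartnerTransport.PartnerLattice

end
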